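import Mathlib
import Summits.NavierStokesRegularity.NavierStokesRegularity.Theorems.EulerZoomLiouvillePowerGaugeEulerLiouvilleDriftClockScale
import HarnessLib

/-!
# «NO APOGEE ⇒ NO RETURN» (class-free tool for the T-D clock `…DriftClockPerigee`)
# (crux `EulerZoomLiouville.PowerGaugeEulerLiouville` = stmt-NavierStokesRegularity-19832, THE ONE STATEMENT `stub_selfSimilarC2Needle`)

Route `EulerZoomLiouville` (NavierStokesRegularity), crux E; width seat ns-ezl-w1 g6.  Setting of the drift clocks (`…DriftClockScale`): `C¹` field `V`,
`W y = γy + V y`, `ℛ(y) = ⟪y, W y⟫` (radial similarity rate), `a(y) = ‖W y‖² + γℛ(y) + ⟪y, DV(y)(W y)⟫ = −(ℛ∘Z)′` along backward arcs `Z′ = −W(Z)`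
(`BandClock.hasDerivAt_radialRate_comp`), any function `P′` in the Bernoulli slot.
(P) NO APOGEE: every far, Bernoulli-high, vortical, exactly CIRCULAR point (`ℛ = 0`) is a strict perigee of its label, `a > 0` (pointwise — no floor, no band).
CONSEQUENCE «NO RETURN»: a high vortical backward arc that starts beyond the threshold with `ℛ ≤ 0` keeps `ℛ ≤ 0` (at a first return to positive values the
rate would vanish at a far high vortical circular point and have derivative `−a < 0` there) and therefore never loses radius (`(‖Z‖²)′ = −2ℛ ≥ 0`).
Compare the floor versions `BandClock.noReturn` / `DriftClock.abs_noReturn` (T-C), which need `a ≥ a₀ > 0` on a band.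

* `DriftClock.rate_nonpos_of_perigee` — (P) ⇒ along the arc `ℛ ≤ 0` and `‖Z t₀‖ ≤ ‖Z s‖`.

WHAT THIS IS NOT: not NS, not E — an ODE lemma, `--supports` stmt-19832; the crux is OPEN; NS regularity is NOT proved.
[folklore; cf. ConstantinIgnatovaVicol2026Putative §3.4 (3.19)–(3.22)]
-/
noncomputable section

-- flat `Theorems/<Route><Decl>…` files of one crux share the namespace of the crux (tree convention: `Summit.<S>.<S>.…`)
set_option linter.dupNamespace false

open Set Filter Topology Metric MeasureTheory
open scoped RealInnerProductSpace ENNReal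

namespace Summit.NavierStokesRegularity.NavierStokesRegularity.Theorems.PowerGaugeEulerLiouville

open Literature.Analysis Literature.Analysis.FluidPDE

namespace DriftClock

open ChannelClock

/-- **(P) ⇒ «NO RETURN»** (`V ∈ C¹`, any `γ`, any function `P′`): along a backward arc `Z′ = −W(Z)` on `[t₀, t₁]` which is Bernoulli-high (`ℋ_{P′} > h`) and
vortical throughout, starts at radius `≥ R₁` with radial rate `ℛ ≤ 0`, and such that every high vortical CIRCULAR point beyond `R₁` is a strict perigee
(`ℛ = 0 ⇒ a > 0`), the radial rate stays `≤ 0` and the radius never decreases. [folklore; ConstantinIgnatovaVicol2026Putative §3.4 (3.19)–(3.22)] -/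
theorem rate_nonpos_of_perigee {γ : ℝ} {V : EuclideanSpace ℝ (Fin 3) → EuclideanSpace ℝ (Fin 3)} {P' : EuclideanSpace ℝ (Fin 3) → ℝ}
    (hV : ContDiff ℝ 1 V) {R₁ h t₀ t₁ : ℝ}
    (hper : ∀ y : EuclideanSpace ℝ (Fin 3), R₁ ≤ ‖y‖ → h < selfSimilarBernoulli γ 0 V P' y → curl V y ≠ 0 →
      ⟪y, selfSimilarTransport γ 0 V y⟫ = 0 →
      0 < ‖selfSimilarTransport γ 0 V y‖ ^ 2 + γ * ⟪y, selfSimilarTransport γ 0 V y⟫ + ⟪y, fderiv ℝ V y (selfSimilarTransport γ 0 V y)⟫)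
    {Z : ℝ → EuclideanSpace ℝ (Fin 3)}
    (hZ : ∀ s ∈ Icc t₀ t₁, HasDerivAt Z (-(selfSimilarTransport γ 0 V (Z s))) s)
    (hhigh : ∀ s ∈ Icc t₀ t₁, h < selfSimilarBernoulli γ 0 V P' (Z s))
    (hvort : ∀ s ∈ Icc t₀ t₁, curl V (Z s) ≠ 0)
    (hZ0 : R₁ ≤ ‖Z t₀‖) (hrate0 : ⟪Z t₀, selfSimilarTransport γ 0 V (Z t₀)⟫ ≤ 0) :
    ∀ s ∈ Icc t₀ t₁, ⟪Z s, selfSimilarTransport γ 0 V (Z s)⟫ ≤ 0 ∧ ‖Z t₀‖ ≤ ‖Z s‖ := by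
  set W := selfSimilarTransport γ 0 V with hWdef
  set g : ℝ → ℝ := fun s => ⟪Z s, W (Z s)⟫ with hgdef
  set N : ℝ → ℝ := fun s => ‖Z s‖ ^ 2 with hNdef
  have hgd : ∀ s ∈ Icc t₀ t₁, HasDerivAt g
      (-(‖W (Z s)‖ ^ 2 + γ * ⟪Z s, W (Z s)⟫ + ⟪Z s, fderiv ℝ V (Z s) (W (Z s))⟫)) s :=
    fun s hs => BandClock.hasDerivAt_radialRate_comp (γ := γ) hV (hZ s hs)
  have hNd : ∀ s ∈ Icc t₀ t₁, HasDerivAt N (2 * ⟪Z s, -(W (Z s))⟫) s := fun s hs => (hZ s hs).norm_sq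
  have hgc : ∀ s ∈ Icc t₀ t₁, ContinuousAt g s := fun s hs => (hgd s hs).continuousAt
  -- radius monotonicity from a sign of `g` on an initial interval
  have hNmono : ∀ u ∈ Icc t₀ t₁, (∀ τ ∈ Icc t₀ u, g τ ≤ 0) → ∀ s ∈ Icc t₀ u, N t₀ ≤ N s := by
    intro u hu hgu s hs
    have hsub : Icc t₀ u ⊆ Icc t₀ t₁ := Icc_subset_Icc_right hu.2
    have hmono : MonotoneOn N (Icc t₀ u) := by
      have hcont : ContinuousOn N (Icc t₀ u) := fun τ hτ => (hNd τ (hsub hτ)).continuousAt.continuousWithinAt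
      have hdiff : DifferentiableOn ℝ N (interior (Icc t₀ u)) := by
        rw [interior_Icc]; exact fun τ hτ => (hNd τ (hsub (Ioo_subset_Icc_self hτ))).differentiableAt.differentiableWithinAt
      refine monotoneOn_of_deriv_nonneg (convex_Icc t₀ u) hcont hdiff fun τ hτ => ?_
      rw [interior_Icc] at hτ
      rw [((hNd τ (hsub (Ioo_subset_Icc_self hτ)))).deriv, inner_neg_right]
      have := hgu τ (Ioo_subset_Icc_self hτ)
      show 0 ≤ 2 * -g τ
      linarith
    exact hmono (left_mem_Icc.2 (hs.1.trans hs.2)) hs hs.1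
  -- ### the sign: `g ≤ 0` on the whole arc
  have hsign : ∀ s ∈ Icc t₀ t₁, g s ≤ 0 := by
    by_contra hnot
    push Not at hnot
    obtain ⟨s₁, hs₁, hgs₁⟩ := hnot
    set B : Set ℝ := {s | s ∈ Icc t₀ t₁ ∧ 0 < g s} with hBdef
    have hBne : B.Nonempty := ⟨s₁, hs₁, hgs₁⟩
    have hBbdd : BddBelow B := ⟨t₀, fun s hs => hs.1.1⟩
    set u : ℝ := sInf B with hudef
    have hut₀ : t₀ ≤ u := le_csInf hBne fun s hs => hs.1.1
    have hus₁ : u ≤ s₁ := csInf_le hBbdd ⟨hs₁, hgs₁⟩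
    have hu : u ∈ Icc t₀ t₁ := ⟨hut₀, hus₁.trans hs₁.2⟩
    -- before `u`, `g ≤ 0`
    have hbefore : ∀ τ ∈ Ico t₀ u, g τ ≤ 0 := by
      intro τ hτ
      by_contra hτg
      push Not at hτg
      have : u ≤ τ := csInf_le hBbdd ⟨⟨hτ.1, le_trans hτ.2.le hu.2⟩, hτg⟩
      exact absurd hτ.2 (not_lt.2 this)
    -- at `u`, `g u ≤ 0` (from the left, or `u = t₀`)
    have hgu : g u ≤ 0 := by
      rcases eq_or_lt_of_le hut₀ with h0 | h0
      · rw [← h0]; exact hrate0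
      · by_contra hpos
        push Not at hpos
        obtain ⟨δ, hδ, hball⟩ := Metric.eventually_nhds_iff.1 ((hgc u hu).eventually (lt_mem_nhds hpos))
        set τ : ℝ := max (u - δ / 2) ((t₀ + u) / 2) with hτdef
        have hτu : τ < u := max_lt (by linarith) (by linarith)
        have hτt₀ : t₀ ≤ τ := le_trans (by linarith) (le_max_right _ _)
        have hτd : dist τ u < δ := by
          rw [Real.dist_eq, abs_sub_lt_iff]
          constructor <;> linarith [le_max_left (u - δ / 2) ((t₀ + u) / 2)]
        exact absurd (hbefore τ ⟨hτt₀, hτu⟩) (not_le.2 (hball hτd))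
    -- hence the radius at `u` is still `≥ R₁`
    have hgle : ∀ τ ∈ Icc t₀ u, g τ ≤ 0 := by
      intro τ hτ
      rcases eq_or_lt_of_le hτ.2 with e | hlt
      · rw [e]; exact hgu
      · exact hbefore τ ⟨hτ.1, hlt⟩
    have hNu : N t₀ ≤ N u := hNmono u hu hgle u (right_mem_Icc.2 hut₀)
    have hZu : R₁ ≤ ‖Z u‖ := by
      have : ‖Z t₀‖ ≤ ‖Z u‖ := by
        have h' : ‖Z t₀‖ ^ 2 ≤ ‖Z u‖ ^ 2 := hNu
        exact (pow_le_pow_iff_left₀ (norm_nonneg _) (norm_nonneg _) two_ne_zero).1 h'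
      exact hZ0.trans this
    -- points of `B` accumulate at `u` from the right
    have hnear : ∀ ε : ℝ, 0 < ε → ∃ b ∈ B, b < u + ε := fun ε hε =>
      exists_lt_of_csInf_lt hBne (by linarith)
    rcases lt_or_eq_of_le hgu with hneg | hzero
    · -- `g u < 0`: then `g < 0` near `u`, contradicting the points of `B` to the right
      obtain ⟨δ, hδ, hball⟩ := Metric.eventually_nhds_iff.1 ((hgc u hu).eventually (gt_mem_nhds hneg))
      obtain ⟨b, hbB, hbu⟩ := hnear δ hδ
      have hub : u ≤ b := csInf_le hBbdd hbB
      have hbd : dist b u < δ := by rw [Real.dist_eq, abs_of_nonneg (by linarith)]; linarith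
      exact absurd hbB.2 (not_lt.2 (hball hbd).le)
    · -- `g u = 0`: a circular far high vortical point — a strict perigee, so `g` decreases through `0`: contradiction again
      have hacc := hper (Z u) hZu (hhigh u hu) (hvort u hu) hzero
      have hd : HasDerivAt (fun s => -g s)
          (‖W (Z u)‖ ^ 2 + γ * ⟪Z u, W (Z u)⟫ + ⟪Z u, fderiv ℝ V (Z u) (W (Z u))⟫) u := by
        have h1 := (hgd u hu).neg
        rw [neg_neg] at h1
        exact h1
      have hev := Literature.NumberTheory.LFunctions.Nicolas.eventually_nhdsGT_lt_of_hasDerivAt_pos hd hacc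
      obtain ⟨δ, hδ, hball⟩ := Metric.eventually_nhds_iff.1 (eventually_nhdsWithin_iff.1 hev)
      obtain ⟨b, hbB, hbu⟩ := hnear δ hδ
      have hub : u ≤ b := csInf_le hBbdd hbB
      have hbne : b ≠ u := by
        intro e; rw [e] at hbB; exact absurd hbB.2 (by rw [hzero]; exact lt_irrefl 0)
      have hbgt : u < b := lt_of_le_of_ne hub (Ne.symm hbne)
      have hbd : dist b u < δ := by rw [Real.dist_eq, abs_of_nonneg (by linarith)]; linarith
      have := hball hbd hbgt
      rw [hzero, neg_zero] at this
      exact absurd hbB.2 (not_lt.2 (by linarith))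
  intro s hs
  refine ⟨hsign s hs, ?_⟩
  have hN : N t₀ ≤ N s := hNmono t₁ (right_mem_Icc.2 (hs.1.trans hs.2)) hsign s hs
  exact (pow_le_pow_iff_left₀ (norm_nonneg _) (norm_nonneg _) two_ne_zero).1 hN

end DriftClock

end Summit.NavierStokesRegularity.NavierStokesRegularity.Theorems.PowerGaugeEulerLiouville

end
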